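import Literature.MathematicalPhysics.KineticTheory.DiPernaLionsConservationProofs
import Literature.MathematicalPhysics.KineticTheory.DiPernaLionsDataApproximationProofs
import Literature.MathematicalPhysics.KineticTheory.DiPernaLionsKernelApproximationProofs
import HarnessLib

/-!
# The approximating scheme of DiPerna–Lions: reduction to the truncated problem

Topic: MathematicalPhysics / KineticTheory. With the conservation laws and the entropy identity
of the approximate solutions (`approximateSolution_conservation_holds`,
`approximateSolution_entropy_identity_holds`; CIP 1994 Lemma 5.3.1), the approximation of the
data (`data_approximation_holds`) and of the kernel (`kernel_approximation_holds`; CIP 1994 §5.3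
Step 7) proved, the existence of the approximating scheme `diPernaLions_approximatingScheme`
(half of the hypotheses of `diperna_lions_of_approximatingScheme_of_weakStability`) is reduced
to the single remaining named fact `truncatedProblem_globalExistence` (global solvability of the
truncated problems in the Schwartz class, CIP 1994 Lemma 5.3.6). Everything is proved; theorems only.

## References

* C. Cercignani, R. Illner, M. Pulvirenti, *The Mathematical Theory of Dilute Gases*, Springer
  (1994), §5.3 Lemma 5.3.1, Lemma 5.3.6, Step 7 (pp. 140–147).
-/

namespace Literature.MathematicalPhysics.KineticTheory

universe u

/-- **The a priori bounds (3.8)–(3.9) of the approximate solutions hold** (CIP 1994 Lemma 5.3.1),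
from the conservation laws and the entropy identity. [cite: CIPDiluteGases1994, §5.3 Lemma 5.3.1 (3.8)–(3.9)] -/
theorem approximateSolution_apriori_bounds_holds : approximateSolution_apriori_bounds.{u} :=
  approximateSolution_apriori_bounds_of approximateSolution_conservation_holds
    approximateSolution_entropy_identity_holds

/-- **The approximating scheme exists as soon as the truncated problems are globally solvable**:
`truncatedProblem_globalExistence → diPernaLions_approximatingScheme` (CIP 1994 §5.3 Steps 6–7;
all other ingredients are theorems of the tree). [cite: CIPDiluteGases1994, §5.3 Steps 6–7 (pp. 145–147)] -/
theorem diPernaLions_approximatingScheme_of_truncatedProblem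
    (hA1 : truncatedProblem_globalExistence.{u}) : diPernaLions_approximatingScheme.{u} :=
  diPernaLions_approximatingScheme_of' hA1 approximateSolution_conservation_holds
    approximateSolution_entropy_identity_holds kernel_approximation_holds data_approximation_holds

end Literature.MathematicalPhysics.KineticTheory
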